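import Literature.MathematicalPhysics.QuantumLattice.GrassmannGaussianSourceDerivative
import Literature.MathematicalPhysics.QuantumLattice.GrassmannIntegralGaussianProofs
import Literature.MathematicalPhysics.QuantumFieldTheory.QCDOS
import HarnessLib

/-!
# Stub `stub_fermiIntegral_sources_det` of line `pin-the-infimum` (crux `RobustYangMillsHandover`, 8892)

E2 (fermionic insertions in Lüscher's transfer form), layer γ1: **Berezin source identities.**

The numerator of a meson correlator is `∫dμ_W(U) ∫dψ̄dψ (ψ̄J₁ψ)(ψ̄J₂ψ) e^{−ψ̄D(U)ψ}`.  The SOURCE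
TRICK (tree `Literature.MathematicalPhysics.QuantumLattice.GrassmannGaussianSourceDerivative`,
landed for every linear functional `φ` on the complex-fermion Grassmann algebra) turns the bilinear
insertions `ψ̄Jψ = quadratic ℂ J` into parameter derivatives of Gaussian Berezin integrals, and the
Gaussian Berezin integral of the tree is `ε · det`:

* `∫dψ̄dψ e^{−ψ̄Mψ} = ε det M`, `ε = (−1)^{n(n−1)/2 + n}`, `n` the number of quark variables
  (Montvay–Münster (4.17): the tree's `berezin (exp (ψ̄Aψ)) = (−1)^{n(n−1)/2} det A`
  (`berezin_grassmannExp_quadratic_holds`) at `A = −M`, and `det (−M) = (−1)^n det M`);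
* `∫dψ̄dψ (ψ̄J₁ψ) e^{−ψ̄Dψ} = d/ds|₀ ε det (D − sJ₁)`;
* `∫dψ̄dψ (ψ̄J₂ψ)(ψ̄J₁ψ) e^{−ψ̄Dψ} = ∂_{s₁}|₀ ∂_{s₂}|₀ ε det (D − s₁J₁ − s₂J₂)`,

for the `N_f`-flavour Wilson–Dirac matrix `D = diracMatrix U mq` of `QCDOS.lean`
(`fermiIntegral = berezin`, `fermiBoltzmann U mq = exp (quadratic ℂ (−D))`) and arbitrary source
matrices `J₁, J₂` on the linear quark index `FermiIdx Nf L`; real source strengths, `HasDerivAt` /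
`deriv` forms.  These feed the transfer-matrix side of the programme (the other stubs express
`det (D − sJ)` through Lüscher's chain).

## Proof

Pointwise in the source strengths, `ε det (D − sJ) = ∫dψ̄dψ e^{ψ̄(−D + sJ)ψ}` (first bullet with
`M = D − sJ`, `−(D − sJ) = −D + sJ`), so the one-source statement is the tree's
`hasDerivAt_apply_mul_grassmannExp_quadratic_add_ofReal_smul_zero fermiIntegral (−D) J 1`
(`d/ds|₀ φ (X e^{ψ̄(A + sJ)ψ}) = φ (X ψ̄Jψ e^{ψ̄Aψ})`, `X = 1`).  For two sources the inner
derivative at `s₂ = 0` is, for every `s₁`, `∫dψ̄dψ (ψ̄J₂ψ) e^{ψ̄(−D + s₁J₁)ψ}` (the one-source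
statement at `D − s₁J₁`, `HasDerivAt.deriv`), and the same tree theorem with the insertion
`X = ψ̄J₂ψ` riding along differentiates this in `s₁`.

References: I. Montvay, G. Münster, *Quantum Fields on a Lattice* (CUP 1994), §4.1 (4.14)–(4.17)
(Grassmann integration, Gaussian integrals with sources); F. A. Berezin, *The Method of Second
Quantization* (1966), Ch. I §3.
-/

noncomputable section

open Literature.MathematicalPhysics.QuantumLattice Literature.MathematicalPhysics.QuantumFieldTheory

namespace Summit.QuantumFields.QCD.Cruxes.RobustYangMillsHandover.PinTheInfimum

namespace StubFermiIntegralSourcesDet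

variable {Nf L : ℕ} [NeZero L]

/-- **Fermionic Gaussian integral**: `∫dψ̄dψ e^{−ψ̄Mψ} = (−1)^{n(n−1)/2 + n} det M` for every
complex matrix `M` on the quark variables, `n = #`quark variables (the tree's Gaussian Berezin
formula `berezin (exp (ψ̄Aψ)) = (−1)^{n(n−1)/2} det A` at `A = −M`, and `det (−M) = (−1)^n det M`).
[cite: MontvayMunster1994, §4.1 (4.14)–(4.17)] -/
theorem fermiIntegral_grassmannExp_quadratic_neg (M : Matrix (FermiIdx Nf L) (FermiIdx Nf L) ℂ) :
    fermiIntegral (grassmannExp (quadratic ℂ (-M))) =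
      (-1 : ℂ) ^ (Fintype.card (FermiIdx Nf L) * (Fintype.card (FermiIdx Nf L) - 1) / 2 +
          Fintype.card (FermiIdx Nf L)) * M.det := by
  simp only [fermiIntegral]
  rw [berezin_grassmannExp_quadratic_holds ℂ (ι := FermiIdx Nf L) (-M), Matrix.det_neg, pow_add,
    mul_assoc]

/-- `ε det (D − sJ) = ∫dψ̄dψ e^{ψ̄(−D + sJ)ψ}` for a real source strength `s`
(`fermiIntegral_grassmannExp_quadratic_neg` at `M = D − sJ`). [cite: MontvayMunster1994, §4.1 (4.14)–(4.17)] -/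
theorem sign_mul_det_sub_smul_eq (D J : Matrix (FermiIdx Nf L) (FermiIdx Nf L) ℂ) (s : ℝ) :
    (-1 : ℂ) ^ (Fintype.card (FermiIdx Nf L) * (Fintype.card (FermiIdx Nf L) - 1) / 2 +
          Fintype.card (FermiIdx Nf L)) * (D - (s : ℂ) • J).det =
      fermiIntegral (grassmannExp (quadratic ℂ (-D + (s : ℂ) • J))) := by
  rw [← fermiIntegral_grassmannExp_quadratic_neg, neg_sub, sub_eq_neg_add]

/-- **One source**: `d/ds|₀ ε det (D − sJ) = ∫dψ̄dψ (ψ̄Jψ) e^{−ψ̄Dψ}` (the source derivative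
`hasDerivAt_apply_mul_grassmannExp_quadratic_add_ofReal_smul_zero` of the Berezin functional with
trivial insertion `X = 1`, after `sign_mul_det_sub_smul_eq`). [cite: MontvayMunster1994, §4.1 (4.14)–(4.17)] -/
theorem hasDerivAt_sign_mul_det_sub_smul (D J : Matrix (FermiIdx Nf L) (FermiIdx Nf L) ℂ) :
    HasDerivAt (fun s : ℝ =>
        (-1 : ℂ) ^ (Fintype.card (FermiIdx Nf L) * (Fintype.card (FermiIdx Nf L) - 1) / 2 +
            Fintype.card (FermiIdx Nf L)) * (D - (s : ℂ) • J).det)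
      (fermiIntegral (quadratic ℂ J * grassmannExp (quadratic ℂ (-D)))) 0 := by
  have h := hasDerivAt_apply_mul_grassmannExp_quadratic_add_ofReal_smul_zero fermiIntegral (-D) J 1
  simp only [one_mul] at h
  have hfun : (fun s : ℝ =>
      (-1 : ℂ) ^ (Fintype.card (FermiIdx Nf L) * (Fintype.card (FermiIdx Nf L) - 1) / 2 +
          Fintype.card (FermiIdx Nf L)) * (D - (s : ℂ) • J).det) =
      fun s : ℝ => fermiIntegral (grassmannExp (quadratic ℂ (-D + (s : ℂ) • J))) :=
    funext fun s => sign_mul_det_sub_smul_eq D J s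
  rwa [hfun]

/-- **The inner derivative of the two-source determinant**: for every `s₁`,
`∂_{s₂}|₀ ε det (D − s₁J₁ − s₂J₂) = ∫dψ̄dψ (ψ̄J₂ψ) e^{ψ̄(−D + s₁J₁)ψ}`
(`hasDerivAt_sign_mul_det_sub_smul` at `D − s₁J₁`). [cite: MontvayMunster1994, §4.1 (4.14)–(4.17)] -/
theorem deriv_sign_mul_det_sub_smul_sub_smul (D J₁ J₂ : Matrix (FermiIdx Nf L) (FermiIdx Nf L) ℂ)
    (s₁ : ℝ) :
    deriv (fun s₂ : ℝ =>
        (-1 : ℂ) ^ (Fintype.card (FermiIdx Nf L) * (Fintype.card (FermiIdx Nf L) - 1) / 2 +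
            Fintype.card (FermiIdx Nf L)) * (D - (s₁ : ℂ) • J₁ - (s₂ : ℂ) • J₂).det) 0 =
      fermiIntegral (quadratic ℂ J₂ * grassmannExp (quadratic ℂ (-D + (s₁ : ℂ) • J₁))) := by
  rw [(hasDerivAt_sign_mul_det_sub_smul (D - (s₁ : ℂ) • J₁) J₂).deriv, neg_sub, sub_eq_neg_add]

/-- **Two sources**: `∂_{s₁}|₀ ∂_{s₂}|₀ ε det (D − s₁J₁ − s₂J₂) = ∫dψ̄dψ (ψ̄J₂ψ)(ψ̄J₁ψ) e^{−ψ̄Dψ}`: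
by `deriv_sign_mul_det_sub_smul_sub_smul` the outer function is
`s₁ ↦ ∫dψ̄dψ (ψ̄J₂ψ) e^{ψ̄(−D + s₁J₁)ψ}`, differentiated by the source derivative with the insertion
`X = ψ̄J₂ψ` riding along. [cite: MontvayMunster1994, §4.1 (4.14)–(4.17)] -/
theorem hasDerivAt_deriv_sign_mul_det_two_sources
    (D J₁ J₂ : Matrix (FermiIdx Nf L) (FermiIdx Nf L) ℂ) :
    HasDerivAt (fun s₁ : ℝ => deriv (fun s₂ : ℝ =>
        (-1 : ℂ) ^ (Fintype.card (FermiIdx Nf L) * (Fintype.card (FermiIdx Nf L) - 1) / 2 +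
            Fintype.card (FermiIdx Nf L)) * (D - (s₁ : ℂ) • J₁ - (s₂ : ℂ) • J₂).det) 0)
      (fermiIntegral (quadratic ℂ J₂ * quadratic ℂ J₁ * grassmannExp (quadratic ℂ (-D)))) 0 := by
  have hfun : (fun s₁ : ℝ => deriv (fun s₂ : ℝ =>
      (-1 : ℂ) ^ (Fintype.card (FermiIdx Nf L) * (Fintype.card (FermiIdx Nf L) - 1) / 2 +
          Fintype.card (FermiIdx Nf L)) * (D - (s₁ : ℂ) • J₁ - (s₂ : ℂ) • J₂).det) 0) =
      fun s₁ : ℝ => fermiIntegral (quadratic ℂ J₂ * grassmannExp (quadratic ℂ (-D + (s₁ : ℂ) • J₁))) :=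
    funext fun s₁ => deriv_sign_mul_det_sub_smul_sub_smul D J₁ J₂ s₁
  rw [hfun]
  exact hasDerivAt_apply_mul_grassmannExp_quadratic_add_ofReal_smul_zero fermiIntegral (-D) J₁
    (quadratic ℂ J₂)

end StubFermiIntegralSourcesDet

/-- **E2 γ1: Berezin source identities for the QCD torus functional.**  For an `SU(3)` gauge field
`U` on the four-torus of side `L`, quark masses `mq`, and source matrices `J₁, J₂` on the quark
variables, with `D = diracMatrix U mq`, `ε = (−1)^{n(n−1)/2 + n}` (`n = #`quark variables):
(1) `∫dψ̄dψ e^{−ψ̄Mψ} = ε det M` for every `M` (Montvay–Münster (4.17), tree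
`berezin_grassmannExp_quadratic_holds` and `det (−M) = (−1)^n det M`);
(2) `d/ds|₀ ε det (D − sJ₁) = ∫dψ̄dψ (ψ̄J₁ψ) e^{−ψ̄Dψ}`;
(3) `∂_{s₁}|₀ ∂_{s₂}|₀ ε det (D − s₁J₁ − s₂J₂) = ∫dψ̄dψ (ψ̄J₂ψ)(ψ̄J₁ψ) e^{−ψ̄Dψ}`
— the source trick (tree `hasDerivAt_apply_mul_grassmannExp_quadratic_add_ofReal_smul_zero`)
specialised to the Berezin integral `fermiIntegral` and the Boltzmann factor `fermiBoltzmann`.  The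
statement is the registered stub signature verbatim. [cite: MontvayMunster1994, §4.1 (4.14)–(4.17)] -/
theorem stub_fermiIntegral_sources_det :
    ∀ (Nf L : ℕ) [NeZero L] (U : GaugeConfig 4 L (Matrix.specialUnitaryGroup (Fin 3) ℂ)) (mq : Fin Nf → ℝ)
      (J₁ J₂ : Matrix (FermiIdx Nf L) (FermiIdx Nf L) ℂ),
      (∀ M : Matrix (FermiIdx Nf L) (FermiIdx Nf L) ℂ,
        fermiIntegral (grassmannExp (quadratic ℂ (-M))) =
          (-1 : ℂ) ^ (Fintype.card (FermiIdx Nf L) * (Fintype.card (FermiIdx Nf L) - 1) / 2 + Fintype.card (FermiIdx Nf L)) * M.det) ∧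
      HasDerivAt (fun s : ℝ =>
          (-1 : ℂ) ^ (Fintype.card (FermiIdx Nf L) * (Fintype.card (FermiIdx Nf L) - 1) / 2 + Fintype.card (FermiIdx Nf L)) *
            (diracMatrix U mq - (s : ℂ) • J₁).det)
        (fermiIntegral (quadratic ℂ J₁ * fermiBoltzmann U mq)) 0 ∧
      HasDerivAt (fun s₁ : ℝ => deriv (fun s₂ : ℝ =>
          (-1 : ℂ) ^ (Fintype.card (FermiIdx Nf L) * (Fintype.card (FermiIdx Nf L) - 1) / 2 + Fintype.card (FermiIdx Nf L)) *
            (diracMatrix U mq - (s₁ : ℂ) • J₁ - (s₂ : ℂ) • J₂).det) 0)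
        (fermiIntegral (quadratic ℂ J₂ * quadratic ℂ J₁ * fermiBoltzmann U mq)) 0 := by
  intro Nf L _ U mq J₁ J₂
  exact ⟨StubFermiIntegralSourcesDet.fermiIntegral_grassmannExp_quadratic_neg,
    StubFermiIntegralSourcesDet.hasDerivAt_sign_mul_det_sub_smul (diracMatrix U mq) J₁,
    StubFermiIntegralSourcesDet.hasDerivAt_deriv_sign_mul_det_two_sources (diracMatrix U mq) J₁ J₂⟩

end Summit.QuantumFields.QCD.Cruxes.RobustYangMillsHandover.PinTheInfimum

end
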